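import Summits.BirchSwinnertonDyer.Rank1Residual.X2.SplitCellCClassIntPNew
import HarnessLib

/-!
# O9 ∩ {SPLIT} at `p ≥ 5`: the PARTNER-SUPPLY form and the ψ-even sub-cell `CellCSplitNotGV` — c2s FROM
# PRINT and NO main-conjecture input (cell `bsd-eis`, seat `bsd-eis-cgshw` g9; route `EisensteinPrimes`,
# crux 4 `BSDpOnCellC` = stmt-BirchSwinnertonDyer-19034, line b1 skeleton v7; the split twin of k5-c4's
# `bsdp_of_cellCNonsplitNotGV_of_pNewValue_of_imcInt` (p436961); THEOREMS ONLY)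

HONEST FRAMING (cell `bsd-eis`, run/shared/lean/pub/bsd-eis/): theorems only; nothing booked; X2 stays
CONSTRUCTION-SHAPED; no label or count moves. `X2/SplitCellCClassIntPNew.lean` (cgshw g9, p438196)
proves the split half of crux 4 at `p ≥ 5` from PUB(24) + c3s♭ + «CTL ∨ switch» + [Mazur's MC on
X2b ∩ {split}]; the MC input serves only the CGLS partner `E^{(d_K)}` when that twist is ψ-odd. On the
ψ-EVEN sub-cell `CellCSplitNotGV` (split X2c pairs with `¬ GVPar W p`; B11 split NotGV: 7 429 @3 ·
280 @5 · 19 @7 cells — e.g. every split X2c pair with a rational point of order `p`,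
`X2.not_gvPar_of_nsmul_eq_zero_of_mult`) the partner lies in the CLOSED sub-cell X2a
(`pPartRankZero_twist_of_not_gvPar`: the twist by the odd, `p`-unramified `χ_K` flips the parity;
Greenberg–Vatsal 2000 + Kato), so NO main-conjecture input remains:

* `bsdp_of_cellC_of_split_of_manin_of_pNewValue_of_imcInt_of_ctl_of_partner` — pointwise,
  partner-supply form (p438196's pointwise theorem with `hMCB` replaced by a supply `hpartner`).
* `bsdp_of_cellCSplitNotGV_of_manin_of_pNewValue_of_imcInt_of_ctl` — pointwise on the ψ-even split
  sub-cell: PUB (incl. Hsieh `hH`, cas-split `hCS`, the two Tate-uniformisation facts `hT`, `hT'` for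
  the parity transport) + c3s♭ + CTL-split at the pair; NO crux 3.
* **`bsdp_of_cellCSplitNotGV_of_pNewValue_of_imcInt_of_ctlOrSwitch`** — CLASS LEVEL at `p ≥ 5`:
  `∀ W p, 5 ≤ p → CellCSplitNotGV W p → BSDp W p` ⇐ PUB + c3s♭ (at every split CellC pair) + «CTL ∨
  switch» per pair (skeleton v7's `stub_ctlOrSwitch` verbatim) — NO c1s, NO c2s, NO crux 3 (299 cells
  @5/@7). Parity is an isogeny invariant at a multiplicative prime (`gvPar_iff_of_isIsogenous_of_mult`).

References: [Castella2018Exceptional] Thms. 2.10–2.11; [GreenbergVatsal2000] Thm. (1.3), §2 p. 28;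
[SilvermanATAEC1994] Thm. V.5.3, Cor. V.5.4; [Hsieh2014] Thm. 1; [KellerYin2024] Thm. 5.1.3 (PRE);
[CastellaEtAl2021] Thm. 5.3.1; [Mazur1978] Cor. 4.1; [MilneADT2006] I.7.3; [Miller2011LMS] Def. 1.1.
-/

set_option autoImplicit false

noncomputable section

open scoped Classical MatrixGroups ModularForm Topology

open Filter CongruenceSubgroup WeierstrassCurve NumberField IsDedekindDomain Field PowerSeries
  Literature.NumberTheory.EllipticCurves Literature.NumberTheory.EllipticCurves.GreenbergSelmer
  Literature.NumberTheory.EllipticCurves.ModularForms Literature.NumberTheory.QuadraticFields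
  Literature.NumberTheory.EllipticCurves.Rank1Residual
  Literature.NumberTheory.EllipticCurves.Rank1Residual.Typed
  Literature.NumberTheory.EllipticCurves.KrizLi2019
  Literature.NumberTheory.EllipticCurves.GreenbergVatsal2000
  Literature.NumberTheory.EllipticCurves.Wuthrich2014
  Literature.NumberTheory.EllipticCurves.SteinWuthrich2013
  Literature.NumberTheory.EllipticCurves.Castella2018
  Literature.NumberTheory.EllipticCurves.Castella2018Exceptional
  Literature.NumberTheory.GaloisRepresentations Literature.NumberTheory.GaloisCohomology
  Literature.NumberTheory.Automorphic
  Summit.BirchSwinnertonDyer.Rank1Residual.X11b.AcSelmer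
  Summit.BirchSwinnertonDyer.Rank1Residual.X11b.Halves
  Summit.BirchSwinnertonDyer.Rank1Residual.X11b

namespace Summit.BirchSwinnertonDyer.Rank1Residual.X2

/-! ### Pointwise at `p ≥ 5`, partner-supply form; the ψ-even split sub-cell -/

section Pointwise

variable (W : WeierstrassCurve ℚ) [W.IsElliptic] [W.IsGloballyMinimal] (p : ℕ) [Fact p.Prime]

/-- **X2c ∩ {SPLIT}, `p ≥ 5`, pointwise with a Manin datum, PARTNER-SUPPLY form — c2s FROM PRINT.**
`bsdp_of_cellC_of_split_of_manin_of_pNewValue_of_imcInt_of_ctl` (p438196) with the partner's rank-zero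
`p`-part taken from a SUPPLY `hpartner` (the shape of k5-c4's
`bsdp_of_cellC_of_not_split_of_manin_of_pNewValue_of_imcInt_of_partner`) instead of Mazur's main
conjecture on X2b ∩ {split}: at the admissible field `K` (odd `d_K < −4`, Heegner for `N_E` and `p`,
`L(E^{d_K},1) ≠ 0`) every globally minimal model `Wd` of the twist with `r_an(Wd) = 0` has
`PPartRankZero Wd p`. Everything else verbatim: the datum, Hsieh's ♭-frame, c3s♭ at it, the value at
`𝟙` from `continuousDisplay_pNew_of_bdpDisplay` + one-sided ♭-V1RIG, CTL-split at the datum, the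
sign-free `bsdp_of_cellC_of_controlOnTreeAt_of_intHalves_of_partner`. CONDITIONAL on every listed
binder; nothing booked. [cite: Castella2018Exceptional, Thm. 2.10 and Thm. 2.11 (arXiv:1507.04260 pp. 13–14)]
[cite: Hsieh2014, Thm. 1 (arXiv:1112.1580 pp. 3–4)] [claim: KellerYin2024, status: under-review]
[cite: Castella2018, Thm. 2.3 (arXiv:1704.06608 p. 5)] [cite: CastellaEtAl2021, Thm. 5.3.1 and (5.5)–(5.7)]
[cite: Miller2011LMS, Def. 1.1] -/
theorem bsdp_of_cellC_of_split_of_manin_of_pNewValue_of_imcInt_of_ctl_of_partner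
    (hnf : exists_isNewformOf) (hH : hsieh2014_exists_anticyclotomicPAdicLFunction)
    (hCS : thm210_thm211_bdpDisplay_pNew)
    (hGZ : ∀ (N : ℕ) [NeZero N] (W : WeierstrassCurve ℚ) (K : Type) [Field K] [NumberField K],
      gross_zagier N W K)
    (hKo : ∀ (N : ℕ) [NeZero N] (W : WeierstrassCurve ℚ) (K : Type) [Field K] [NumberField K],
      kolyvagin N W K)
    (hHP : ∀ (N : ℕ) [NeZero N] (W : WeierstrassCurve ℚ) (K : Type) [Field K] [NumberField K],
      heegnerPointComplex_mem_range_map N W K)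
    (hGZK : rank_eq_analyticRank_of_analyticRank_le_one)
    (hHL : HoffsteinLuo1997_exists_twist_L_one_ne_zero)
    (hp5 : 5 ≤ p) (hc : CellC W p) (hs : W.HasSplitMultiplicativeReductionAtPrime p)
    (hMan : HasPrimeToManinDatum W p) (h3 : SplitIMCEqOnTreeInt W p) (hCTL : SplitControlOnTree W p)
    (hpartner : ∀ (K : Type) [Field K] [NumberField K], IsImaginaryQuadratic K →
        Odd (NumberField.discr K) → NumberField.discr K < -4 →
        SatisfiesHeegnerHypothesis (W.conductorNorm ℤ) K → SatisfiesHeegnerHypothesis p K →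
        (W.quadraticTwist (NumberField.discr K : ℚ)).entireLFunction 1 ≠ 0 →
      ∀ (Wd : WeierstrassCurve ℚ) [Wd.IsElliptic] [Wd.IsGloballyMinimal],
        (∃ C : VariableChange ℚ, C • Wd = W.quadraticTwist (NumberField.discr K : ℚ)) →
        Wd.analyticRank = 0 → PPartRankZero Wd p) :
    BSDp W p := by
  have hp : p.Prime := Fact.out
  have hmod : hasEntireLFunction_rat := WeierstrassCurve.hasEntireLFunction_rat_of_exists_isNewformOf hnf
  obtain ⟨hr, hp2, hred, hmult⟩ := hc
  haveI : NeZero (W.conductorNorm ℤ) := ⟨(W.conductorNorm_pos_holds).ne'⟩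
  -- `w(E) = -1`
  have hw : W.rootNumber = -1 := by
    rw [WeierstrassCurve.rootNumber_eq_neg_one_pow_analyticRank_of_exists_isNewformOf hnf W, hr]
    norm_num
  -- the admissible auxiliary field (odd `d_K < -4`, Heegner for `N_E`, `L(E^{d_K},1) ≠ 0`)
  obtain ⟨K, _, _, hK, hodd, hlt, hHN, hHp, hLK⟩ :=
    exists_admissibleField_of_rootNumber_eq_neg_one hnf hHL W hw p
  -- the datum with `p ∤ c`, a Heegner datum and the `K`-rational Heegner point READ THROUGH `w₀`
  obtain ⟨Dt, hcM⟩ := hMan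
  obtain ⟨β, hβ⟩ := exists_dvd_sq_sub_discr_holds (W.conductorNorm ℤ) K hK hHN
  obtain ⟨H, -⟩ := nonempty_heegnerDatum_holds (W.conductorNorm ℤ) K hK hβ
  obtain ⟨w₀⟩ := (inferInstance : Nonempty (InfinitePlace K))
  obtain ⟨P, hP⟩ := hHP (W.conductorNorm ℤ) W K hK hHN Dt H w₀.embedding
  -- the Heegner point has infinite order: `L'(E/K,1) = L'(E,1)·L(E^K,1) ≠ 0` (Gross–Zagier)
  have hL0 : W.entireLFunction 1 = 0 := entireLFunction_one_eq_zero_of_analyticRank_eq_one hr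
  obtain ⟨-, hderiv⟩ := leadingLCoeff_eq_deriv_of_analyticRank_eq_one hr
  have hLKd : LDerivEK W K ≠ 0 := by
    rw [lDerivEK_eq_deriv_mul W K hmod hL0]
    exact mul_ne_zero hderiv hLK
  have hPH : IsHeegnerPoint (W.conductorNorm ℤ) W K P := ⟨Dt, H, w₀.embedding, hP⟩
  have hPinf : ¬ IsOfFinAddOrder P :=
    (lDerivEK_ne_zero_iff_not_isOfFinAddOrder W (W.conductorNorm ℤ) K (hGZ _ W K) hK hHN hPH).mp hLKd
  -- a globally minimal model of the twist (Néron) and its transport values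
  have hD0 : (NumberField.discr K : ℚ) ≠ 0 := by exact_mod_cast NumberField.discr_ne_zero K
  haveI hEt : (W.quadraticTwist (NumberField.discr K : ℚ)).IsElliptic :=
    W.isElliptic_quadraticTwist hD0
  obtain ⟨Cd, hCd⟩ := hasGlobalMinimalModel_rat_holds (W.quadraticTwist (NumberField.discr K : ℚ))
  set Wd : WeierstrassCurve ℚ := Cd • W.quadraticTwist (NumberField.discr K : ℚ) with hWd_def
  haveI : Wd.IsGloballyMinimal := hCd
  have hWd : Cd • W.quadraticTwist (NumberField.discr K : ℚ) = Wd := rfl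
  have hC : Cd⁻¹ • Wd = W.quadraticTwist (NumberField.discr K : ℚ) := by
    rw [← hWd, inv_smul_smul]
  obtain ⟨htam, hu⟩ := twistTransportPackage_holds W p K Wd Cd ⟨hr, hp2, hred, hmult⟩ hK hodd hHN hWd
  have htamK : padicValNat p (W.baseChange K).tamagawaProduct = 2 * padicValNat p W.tamagawaProduct :=
    padicValNat_tamagawaProduct_baseChange_of_heegner_odd W p hp2 K hK hodd hHN hHp
  -- the twist has analytic rank `0`; its rank-zero `p`-part from the supply
  have hLd : Wd.entireLFunction 1 ≠ 0 := by
    rw [← hWd, entireLFunction_smul]; exact hLK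
  have hrd : Wd.analyticRank = 0 := (Wd.analyticRank_eq_zero_iff_holds (hmod _)).2 hLd
  have htw : PPartRankZero Wd p := hpartner K hK hodd hlt hHN hHp hLK Wd ⟨Cd⁻¹, hC⟩ hrd
  -- the anticyclotomic `ℤ_p`-extension, a topological generator, a degree-one prime above `p`
  haveI : IsTotallyComplex K := hK.2
  obtain ⟨κ, hκ⟩ := ZpExtension.exists_isAnticyclotomic_holds (K := K) (p := p) hK.1
    (fun w ↦ IsTotallyComplex.isComplex w)
  obtain ⟨γ, hγ⟩ := κ.surjective (Multiplicative.ofAdd 1)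
  haveI : Fact (κ.IsTopGenerator γ) := ⟨hγ⟩
  have hpN : p ∣ W.conductorNorm ℤ := X11b.dvd_conductorNorm_of_mult (W := W) hmult
  have hp2N : ¬ p ^ 2 ∣ W.conductorNorm ℤ := not_sq_dvd_conductorNorm_of_mult W p hmult
  obtain ⟨𝔭, h𝔭, he, hf⟩ := X11b.exists_degreeOnePrime_of_splitsIn K p hK.1 (hHp p hp dvd_rfl)
  -- an embedding datum inducing `𝔭`, Hsieh's ♭-frame there (for the newform `Dt.f`), c3s♭ at it
  obtain ⟨ι₀⟩ := PadicAlgCl.nonempty_ringEquiv_complex p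
  obtain ⟨ι', -, hι'⟩ := X11b.exists_datum_forall_mem_iff p ι₀ hK h𝔭
  obtain ⟨ΩK', Ωp', Q, hΩK', hΩp', hQ⟩ := exists_isBDPLFunctionInt_of_hsieh2014_of_classX2 W p hH ι' 𝔭
    κ γ Dt.isNewformOf ⟨hp2, hred, hmult⟩ rfl hK hHN h𝔭 hι' hκ hγ
  have hΩp0' : Ωp' ≠ 0 := fun h0 ↦ by rw [h0, norm_zero] at hΩp'; exact zero_ne_one hΩp'
  have h3Q : R1.IMCEqIntAt W p κ 𝔭 γ Q :=
    h3 (W.conductorNorm ℤ) K Dt H w₀.embedding P ⟨hr, hp2, hred, hmult⟩ hs rfl hK hlt hHN hLK hP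
      hcM hPinf κ hκ γ 𝔭 h𝔭 he hf Dt.f Dt.isNewformOf ι' hι' ΩK' Ωp' Q hΩK' hΩp' hQ
  -- the value at `𝟙` of `Q` from print: continuity display + one-sided value rigidity
  have hemb : ∀ k : 𝓞 K, k ∈ 𝔭.asIdeal ↔ ‖embAt K p 𝔭 h𝔭 he hf (k : K)‖ < 1 :=
    mem_asIdeal_iff_norm_embAt_lt_one 𝔭 h𝔭 he hf
  obtain ⟨ΩK₀, Ωp₀, u₀, hΩK₀, hΩp₀, hu₀, hcont⟩ := continuousDisplay_pNew_of_bdpDisplay hCS ι' W K 𝔭 κ γ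
    Dt H w₀ (embAt K p 𝔭 h𝔭 he hf)
    P hp5 rfl hpN hp2N hK hodd (hHN p hp hpN) h𝔭 hι' hHN hκ hγ hcM hP hemb
  have ha : ¬ (p : ℤ) ∣ W.LFunction p := X11b.R1.not_dvd_lFunction_of_mult Dt.isNewformOf hmult
  have hX : algebraMap ℚ_[p] ℂ_[p] (((1 : ℚ_[p]) - ((W.LFunction p : ℤ) : ℚ_[p]) * (p : ℚ_[p])⁻¹) *
      padicLogOmega W p (embAt K p 𝔭 h𝔭 he hf) P) ≠ 0 := by
    rw [map_ne_zero_iff _ (algebraMap ℚ_[p] ℂ_[p]).injective]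
    refine mul_ne_zero ?_ ?_
    · intro h0
      have h := X11b.R1.norm_one_sub_div_eq p ha
      rw [h0, norm_zero] at h
      have hp0 : (0 : ℝ) < p := by exact_mod_cast hp.pos
      exact absurd h (ne_of_lt hp0)
    · rw [← X11b.R1.logOmega_eq_padicLogOmega]
      exact X11b.R1.logOmega_ne_zero W p _ hPinf
  have hu₀0 : u₀ ≠ 0 := fun h0 ↦ by rw [h0, norm_zero] at hu₀; exact zero_ne_one hu₀
  have hc0 : u₀ * (algebraMap ℚ_[p] ℂ_[p] (((1 : ℚ_[p]) - ((W.LFunction p : ℤ) : ℚ_[p]) *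
      (p : ℚ_[p])⁻¹) * padicLogOmega W p (embAt K p 𝔭 h𝔭 he hf) P)) ^ 2 ≠ 0 :=
    mul_ne_zero hu₀0 (pow_ne_zero _ hX)
  have heq := X11b.intSeries_constantCoeff_eq_of_isBDPLFunctionInt_of_continuousValues hp2 hK hκ hγ
    hΩK₀ hΩK' hΩp₀ hΩp0' hcont hc0 hQ
  have h2Q : R1.BDPValueAtOneIntAt W p (embAt K p 𝔭 h𝔭 he hf) P Q (W.LFunction p) := by
    refine ⟨u₀, hu₀, ?_⟩
    rw [X11b.R1.logOmega_eq_padicLogOmega, ← heq]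
    exact X11b.R1.intSeries_hasValueAt_zero p Q
  -- CTL-split at the datum, then the sign-free pointwise assembly over the wide receptacle
  have hCTLd : ControlOnTreeAt p κ 𝔭 γ (embAt K p 𝔭 h𝔭 he hf) P :=
    hCTL K P ⟨hr, hp2, hred, hmult⟩ hs hK hHp hLK hPinf κ hκ γ 𝔭 h𝔭 he hf
  exact bsdp_of_cellC_of_controlOnTreeAt_of_intHalves_of_partner W p hnf (W.conductorNorm ℤ) K Dt H
    w₀.embedding P (hGZ _ W K) (hKo _ W K) hGZK ⟨hr, hp2, hred, hmult⟩ rfl hK hlt hHN hP hcM hLK Wd Cd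
    hWd htw htam hu htamK κ 𝔭 γ h𝔭 he hf hCTLd Q h3Q h2Q


/-- **The ψ-even split sub-cell `CellCSplitNotGV`, `p ≥ 5`, pointwise with a Manin datum — c2s FROM
PRINT, NO main-conjecture input.** For a rank-one X2 pair at a SPLIT `p ≥ 5` with `¬ GVPar W p`
carrying a prime-to-`p` Manin datum: `BSD(E,p)` from PUBLISHED facts (incl. `hH`, `hCS`, and the two
Tate-uniformisation facts `hT`, `hT'`), c3s♭ and CTL-split at the pair — the CGLS partner's rank-zero
`p`-part is `pPartRankZero_twist_of_not_gvPar` (the twist is ψ-odd, in the CLOSED sub-cell X2a).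
CONDITIONAL on every listed binder; nothing booked.
[cite: GreenbergVatsal2000, Thm. (1.3) and §2 p. 28] [cite: SilvermanATAEC1994, Thm. V.5.3 and Cor. V.5.4]
[cite: Castella2018Exceptional, Thm. 2.10 and Thm. 2.11 (arXiv:1507.04260 pp. 13–14)]
[cite: Hsieh2014, Thm. 1 (arXiv:1112.1580 pp. 3–4)] [claim: KellerYin2024, status: under-review]
[cite: Miller2011LMS, Def. 1.1] -/
theorem bsdp_of_cellCSplitNotGV_of_manin_of_pNewValue_of_imcInt_of_ctl
    (hGV : lambdaMu_multiplicative_of_gvPar) (hWu : thm16_charIdeal_dvd_multiplicative_of_reducible)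
    (hJs : thm61_splitMultiplicative) (hJn : thm61_nonsplitMultiplicative)
    (hHs : exists_isSplitMultCanonical) (hHn : exists_isMultCanonical)
    (hpar : nonempty_modularParametrizationData)
    (hGS : ∀ (W : WeierstrassCurve ℚ) [W.IsElliptic] [W.IsGloballyMinimal] (p : ℕ) [Fact p.Prime],
      greenberg_stevens (W := W) (p := p))
    (hnf : exists_isNewformOf) (hH : hsieh2014_exists_anticyclotomicPAdicLFunction)
    (hCS : thm210_thm211_bdpDisplay_pNew)
    (hGZ : ∀ (N : ℕ) [NeZero N] (W : WeierstrassCurve ℚ) (K : Type) [Field K] [NumberField K],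
      gross_zagier N W K)
    (hKo : ∀ (N : ℕ) [NeZero N] (W : WeierstrassCurve ℚ) (K : Type) [Field K] [NumberField K],
      kolyvagin N W K)
    (hHP : ∀ (N : ℕ) [NeZero N] (W : WeierstrassCurve ℚ) (K : Type) [Field K] [NumberField K],
      heegnerPointComplex_mem_range_map N W K)
    (hGZK : rank_eq_analyticRank_of_analyticRank_le_one)
    (hHL : HoffsteinLuo1997_exists_twist_L_one_ne_zero)
    (hp5 : 5 ≤ p) (hc : CellCSplitNotGV W p)
    (hMan : HasPrimeToManinDatum W p) (h3 : SplitIMCEqOnTreeInt W p) (hCTL : SplitControlOnTree W p) :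
    BSDp W p := by
  obtain ⟨hcC, hs, hnot⟩ := hc
  have hmod : hasEntireLFunction_rat := WeierstrassCurve.hasEntireLFunction_rat_of_exists_isNewformOf hnf
  exact bsdp_of_cellC_of_split_of_manin_of_pNewValue_of_imcInt_of_ctl_of_partner W p hnf hH hCS hGZ hKo
    hHP hGZK hHL hp5 hcC hs hMan h3 hCTL
    (fun K _ _ hK _ _ _ hHp _ Wd _ _ hWd hrd ↦
      pPartRankZero_twist_of_not_gvPar hGV hWu hJs hJn hHs hHn hGZK hmod hpar hGS W p hcC.2 hnot K hK
        hHp Wd hWd hrd)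

end Pointwise

/-! ### Class level at `p ≥ 5` on the ψ-even split sub-cell: PUBLISHED facts + c3s♭ + «CTL ∨ switch» -/

section ClassLevel

/-- **`CellCSplitNotGV` ⇒ `BSD(E,p)` at `p ≥ 5`, CLASS LEVEL — NO c1s, NO c2s, NO main-conjecture
input.** For every rank-one X2 pair at a SPLIT `p ≥ 5` with `¬ GVPar W p`: `BSD(E,p)` from the
PUBLISHED named facts (incl. `hH`, `hCS`, `hT`, `hT'`, the five cohomological facts of the control
theorem, Edixhoven/Mazur/Cassels), c3s♭ at every split CellC pair (`h3`, Keller–Yin Thm. D shape,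
PRE) and «CTL-split ∨ étale switch» per pair (`hcs` = skeleton v7's `stub_ctlOrSwitch` verbatim).
Proof: move to the optimal curve `W₀` (`bsdp_of_cellC_of_forall_isIsogenous`); parity and the split
type are isogeny invariants at a multiplicative prime (`gvPar_iff_of_isIsogenous_of_mult`); case on
the disjunction at `W₀`: CTL ⟹ the pointwise theorem; switch `W′ ∼ W₀` ⟹ the same at `W′` with CTL
the THEOREM `splitControlOnTree_of_cellC_of_noPadicPTorsion`, back by Cassels. CONDITIONAL on every
listed binder; nothing booked; X2 CONSTRUCTION-SHAPED; no label change.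
[cite: GreenbergVatsal2000, Thm. (1.3) and §2 p. 28] [cite: SilvermanATAEC1994, Thm. V.5.3 and Cor. V.5.4]
[cite: Castella2018Exceptional, Thm. 2.10 and Thm. 2.11 (arXiv:1507.04260 pp. 13–14)]
[cite: CastellaEtAl2021, Thm. 5.3.1] [cite: Mazur1978, Cor. 4.1] [cite: MilneADT2006, Thm. I.7.3]
[cite: Castella2018, Thm. 2.3 (arXiv:1704.06608 p. 5)] [claim: KellerYin2024, status: under-review] -/
theorem bsdp_of_cellCSplitNotGV_of_pNewValue_of_imcInt_of_ctlOrSwitch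
    (hGV : lambdaMu_multiplicative_of_gvPar) (hWu : thm16_charIdeal_dvd_multiplicative_of_reducible)
    (hJs : thm61_splitMultiplicative) (hJn : thm61_nonsplitMultiplicative)
    (hHs : exists_isSplitMultCanonical) (hHn : exists_isMultCanonical)
    (hpar : nonempty_modularParametrizationData)
    (hGS : ∀ (W : WeierstrassCurve ℚ) [W.IsElliptic] [W.IsGloballyMinimal] (p : ℕ) [Fact p.Prime],
      greenberg_stevens (W := W) (p := p))
    (hnf : exists_isNewformOf)
    (hPT : ∀ (K : Type) [Field K] [NumberField K], poitouTate_selmerStructure_duality K)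
    (hPT2 : ∀ (K : Type) [Field K] [NumberField K], poitouTate_sha_tateDual K)
    (hEP : ∀ (K : Type) [Field K] [NumberField K] (v : HeightOneSpectrum (𝓞 K)),
      localEulerPoincareCharacteristic (v.adicCompletion K))
    (hcd : fieldCdLE_two_of_numberField)
    (hBr : ∀ (K : Type) [Field K] [NumberField K] (p : ℕ) [Fact p.Prime],
      ZpExtension.decomp_not_le_kerSubgroup_of_isAnticyclotomic K p)
    (hH : hsieh2014_exists_anticyclotomicPAdicLFunction)
    (hCS : thm210_thm211_bdpDisplay_pNew)
    (hGZ : ∀ (N : ℕ) [NeZero N] (W : WeierstrassCurve ℚ) (K : Type) [Field K] [NumberField K],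
      gross_zagier N W K)
    (hKo : ∀ (N : ℕ) [NeZero N] (W : WeierstrassCurve ℚ) (K : Type) [Field K] [NumberField K],
      kolyvagin N W K)
    (hHP : ∀ (N : ℕ) [NeZero N] (W : WeierstrassCurve ℚ) (K : Type) [Field K] [NumberField K],
      heegnerPointComplex_mem_range_map N W K)
    (hGZK : rank_eq_analyticRank_of_analyticRank_le_one)
    (hHL : HoffsteinLuo1997_exists_twist_L_one_ne_zero)
    (hEd : edixhoven_optimalManinConstant_integral) (hMaz : mazur_not_dvd_maninConstant_of_odd)
    (hCassels : bsdRHS_eq_of_isIsogenous)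
    (hT : Silverman1994_thmV53_tateUniformisation.{0})
    (hT' : Silverman1994_thmV53_corV54_tateUniformisation.{0})
    (h3 : ∀ (W : WeierstrassCurve ℚ) [W.IsElliptic] [W.IsGloballyMinimal] (p : ℕ) [Fact p.Prime],
      CellC W p → W.HasSplitMultiplicativeReductionAtPrime p → SplitIMCEqOnTreeInt W p)
    (hcs : ∀ (W : WeierstrassCurve ℚ) [W.IsElliptic] [W.IsGloballyMinimal] (p : ℕ) [Fact p.Prime],
      CellC W p → W.HasSplitMultiplicativeReductionAtPrime p →
        SplitControlOnTree W p ∨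
          ∃ (W' : WeierstrassCurve ℚ) (_ : W'.IsElliptic) (_ : W'.IsGloballyMinimal),
            IsIsogenous W W' ∧ HasPrimeToManinDatum W' p ∧
              ∀ Q₀ : (W'.baseChange ℚ_[p]).toAffine.Point, p • Q₀ = 0 → Q₀ = 0)
    (W : WeierstrassCurve ℚ) [W.IsElliptic] [W.IsGloballyMinimal] (p : ℕ) [Fact p.Prime]
    (hp5 : 5 ≤ p) (hc : CellCSplitNotGV W p) : BSDp W p := by
  obtain ⟨hcC, hs, hnot⟩ := hc
  have hmod : hasEntireLFunction_rat := hasEntireLFunction_rat_of_exists_isNewformOf hnf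
  refine bsdp_of_cellC_of_forall_isIsogenous hEd hMaz hCassels hpar hnf hGZK W p hcC ?_
  intro W₀ _ _ hiso hc₀ hMan₀
  have hs₀ : W₀.HasSplitMultiplicativeReductionAtPrime p :=
    IsogenyQuotientLine.hasSplitMultiplicativeReductionAtPrime_of_isIsogenous hiso hs
  have hnot₀ : ¬ GVPar W₀ p := fun h ↦
    hnot ((gvPar_iff_of_isIsogenous_of_mult hT hT' hcC.2.1 hcC.2.2.2 hiso).mpr h)
  rcases hcs W₀ p hc₀ hs₀ with hCTL₀ | ⟨W', _, _, hiso', hMan', h0'⟩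
  · exact bsdp_of_cellCSplitNotGV_of_manin_of_pNewValue_of_imcInt_of_ctl W₀ p hGV hWu hJs hJn hHs hHn
      hpar hGS hnf hH hCS hGZ hKo hHP hGZK hHL hp5 ⟨hc₀, hs₀, hnot₀⟩ hMan₀ (h3 W₀ p hc₀ hs₀) hCTL₀
  · have hc' : CellC W' p := CellC.of_isIsogenous hiso' hc₀
    have hs' : W'.HasSplitMultiplicativeReductionAtPrime p :=
      IsogenyQuotientLine.hasSplitMultiplicativeReductionAtPrime_of_isIsogenous hiso' hs₀
    have hnot' : ¬ GVPar W' p := fun h ↦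
      hnot₀ ((gvPar_iff_of_isIsogenous_of_mult hT hT' hc₀.2.1 hc₀.2.2.2 hiso').mpr h)
    have hCTL' : SplitControlOnTree W' p :=
      splitControlOnTree_of_cellC_of_noPadicPTorsion W' p hGZK hnf hPT hPT2 hEP hcd hBr hc' h0'
    have hb' : BSDp W' p :=
      bsdp_of_cellCSplitNotGV_of_manin_of_pNewValue_of_imcInt_of_ctl W' p hGV hWu hJs hJn hHs hHn hpar
        hGS hnf hH hCS hGZ hKo hHP hGZK hHL hp5 ⟨hc', hs', hnot'⟩ hMan' (h3 W' p hc' hs') hCTL'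
    exact bsdp_of_isIsogenous_of_bsdp hCassels hGZK hmod W' W₀ hiso'.symm_of_charZero p (by rw [hc'.1])
      hb'

end ClassLevel

end Summit.BirchSwinnertonDyer.Rank1Residual.X2

end
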